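import Summits.QuantumFields.YangMills.Theses.RandomConstraintAnnealing
import Summits.QuantumFields.YangMills.Theorems.RandomConstraintAnnealingTotalCovarianceGlue
import HarnessLib

/-!
# `RandomConstraintAnnealing.Assembly` (item stmt-QuantumFields-16156)

`QuenchedTubeGapInMean → ThresholdDecorrelation → LatticeGapToClay → YangMills`: the two Edwards–Sokal cruxes give the
volume-uniform lattice gap `TubeGapLatticeLeg` by the landed law-of-total-covariance glue
(`totalCovarianceGlue_proof`, item 8720), and `LatticeGapToClay` turns it into the summit statement.  Bookkeeping only:
the three hypotheses are OPEN cruxes of the route; the Yang–Mills mass gap is NOT proved here.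
-/

namespace Summit.QuantumFields.YangMills.Theorems.RandomConstraintAnnealing

/-- **Route item `RandomConstraintAnnealing.Assembly` (stmt-QuantumFields-16156):** the cruxes-to-summit statement,
`fun h₁ h₂ hclay => hclay (totalCovarianceGlue_proof h₁ h₂)`. -/
theorem assembly_proof : Summit.QuantumFields.YangMills.Theses.RandomConstraintAnnealing.Assembly :=
  fun h₁ h₂ hclay => hclay (totalCovarianceGlue_proof h₁ h₂)

end Summit.QuantumFields.YangMills.Theorems.RandomConstraintAnnealing
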